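import Summits.Langlands.Langlands.Theorems.PicardMuOrdinaryMuOrdinaryFamilyRTThorneReduction
import Summits.Langlands.Langlands.Theorems.PicardMuOrdinaryMuOrdinaryFamilyRTThorneDebts
import Summits.Langlands.Langlands.Theorems.PicardMuOrdinaryMuOrdinaryFamilyRTThornePointGalois
import Summits.Langlands.Langlands.Theorems.PicardMuOrdinaryMuOrdinaryFamilyRTThorneRbarAdequateUncond
import Summits.Langlands.Langlands.Theorems.PicardMuOrdinaryMuOrdinaryFamilyRTThorneCompanionsReduction
import Summits.Langlands.Langlands.Theorems.PicardMuOrdinaryMuOrdinaryFamilyRTThorneArithmeticPoints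
import Summits.Langlands.Langlands.Theorems.PicardMuOrdinaryMuOrdinaryFamilyRTThorneAuxiliaryField
import Summits.Langlands.Langlands.Theorems.PicardMuOrdinaryMuOrdinaryFamilyRTThorneTwistReduction
import Summits.Langlands.Langlands.Theorems.PicardMuOrdinaryMuOrdinaryFamilyRTThornePointAutomorphicDebts
import Summits.Langlands.Langlands.Theorems.PicardMuOrdinaryMuOrdinaryFamilyRTThornePAIAssembly
import Literature.NumberTheory.GaloisRepresentations.LocalArtinMapNormCompatible
import Literature.NumberTheory.NumberFields.SolubleCMExtensionPrescribedLocal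
import Literature.NumberTheory.PAdicHodge.CrystallineOfOrdinaryRegular
import Literature.NumberTheory.GaloisRepresentations.CyclotomicCharacterArtinNorm
import Summits.Langlands.Langlands.Theorems.MuOrdinaryFamilyRT.Negative.AccumulationDominance
import Summits.Langlands.Langlands.Theorems.MuOrdinaryFamilyRT.Negative.AccumulationNormality
import Summits.Langlands.Langlands.Theorems.MuOrdinaryFamilyRT.Negative.ScopeVacuity
import HarnessLib

/-!
# Line `thorne-minimal-lift` — skeleton v9 (lead prover-line-stmt-Langlands-13757-c3-0, 2026-08-17)
# for the crux `Summit.Langlands.Langlands.Theses.PicardMuOrdinary.MuOrdinaryFamilyRT` (stmt-Langlands-13757)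

v1 = the strategist's `Lines/thorne_minimal_lift.lean` (f4aa57de, 6 stubs).  Its vocabulary and the STATEMENTS
of its six stubs are LANDED (`…ThorneDefs`, p137392: `PotUnramifiedAway`, `MainClassPlus`, `pointRep`,
`PotUnramifiedFamily`, `HasOrdinaryCompanion`, `IsClassicalOver`, `T.stub_*`), and so is the kernel-checked
composition (`…ThorneReduction`, p140646: `definiteHostPlus_of`, `MuOrdinaryFamilyRT_of_plus`,
`MuOrdinaryFamilyRT_of_thorneStubs`).  This file only RESHAPES the stub set (wave-1 returns):

* `stub_thorneLift` (pointwise minimal lifting) is SPLIT along its printed joint into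
  - `stub_pointGalois` — the GALOIS HALF, provable in the tree: the point representation `ρ_y = y ∘ 𝓕.ρ` of an
    `𝔪_R`-adically continuous integral point `y` is a continuous framed representation (automatic continuity),
    and it is absolutely irreducible over the quadratic `F'/K` (integral model with reduction the `S₄` heart
    `r̄_f^B`, which is absolutely irreducible — tree `FreeSeedSmoothRt.rbarAbsIrreducible` — so Burnside form
    `HasAbsolutelyIrreducibleReduction`, tree `….isAbsolutelyIrreducible`, then Clifford for odd rank `3` on the
    index-`2` subgroup, tree `IsAbsolutelyIrreducible.restrictField_of_finrank_eq_two`);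
  - `stub_pointAutomorphic` — the AUTOMORPHIC HALF: given the ordinary automorphic companion over `F'`
    (`HasOrdinaryCompanion`) and the framed, absolutely irreducible `ρ_y`, produce the regular algebraic
    cuspidal `P'` on `GL₃(𝔸_{F'})` attached to `ρ_y|Γ_{F'}` off `S'` with integral `N w · Satake` — Thorne,
    Math. Z. 285 (2017) Thm 5.1 (minimal automorphy lifting, every `p`, extended adequacy Def 2.20 allowing
    `p ∣ n`, `ζ_p ∈ F` allowed by Prop 2.21) over a soluble CM `L/F'` killing the finite inertial images
    (CHT Lemma 4.1.2), `∼` at `w ∣ 3` by BLGGT Lemma 1.4.3(1), soluble descent (BLGGT Lemma 2.2.2 / ACC+ soluble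
    descent, tree `ACCGHLNSTT2023.solubleDescent_isAutomorphic`), local–global compatibility at unramified `w`
    (HLTT).  CONDITIONAL on those named facts (to be typed in `Literature/NumberTheory/Automorphic/`).
  `thorneLift_of_point` recomposes `T.stub_thorneLift` from the two (kernel-checked below).
* the other five stubs are unchanged (`stub_minimalFamily` K2⁺ — wave 1: blocked on the unprinted minimal
  ordinary branch at the RAMIFIED prime, `Missing.minimalOrdinaryBranch`; `stub_finiteOverWeights` — wave 1:
  `= LambdaOrdinaryMinimalFinite ∘ RbarExtendedAdequate`, the first an unprinted `Λ`-adic `R^{red} = T` port,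
  the second dischargeable from GHT Thm 1.7; `stub_companions`; `stub_remainderPlus` (conceded complement);
  `stub_facts` (Literature debts of char-zero's conditional stubs)).

v3 (after wave 2).  LANDED: `stub_pointGalois` (…ThornePointGalois, p142159 — unconditional), the helper
`rbarExtendedAdequate_of` (…ThorneRbarAdequate p144148 + …ThorneAdequateTransport p143432: the `S₄` heart image IS
extended-adequate, from the GHT Thm 1.7 named fact, `Gal(f/K) = S₄` from the two discriminant conditions, no abelian normal
subgroup of index `3`, `24 < 360`), and the typed debts (…ThorneDebts p141007, with `stub_finiteOverWeights_of`).  Hence the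
stub set is now (6 stubs, 6 sorries):
`stub_minimalFamily` (K2⁺; blocked on the unprinted M1), `stub_lambdaFinite` (= `LambdaOrdinaryMinimalFinite`, the unprinted
`Λ`-adic port; `T.stub_finiteOverWeights` is DERIVED from it, GHT and the landed helper), `stub_companions` (wave 2: blocked on Hida
theory for the definite `U(3)` — `Missing.hidaOrdinaryCompanions` — and an ordinary-polarized strengthening of the seed items),
`stub_pointAutomorphic` (lead; Thorne 2017 Thm 5.1 = cite item wi-37169 + BLGGT/CHT/Caraiani facts), `stub_remainderPlus` (conceded
complement), `stub_namedFacts` (= `T.stub_facts ∧` GHT 2017 Thm 1.7: the seven NAMED Literature facts the conditional pieces rest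
on — literature-prover debts, none discharged: wave-2 audit `stub_facts.md`).
v4 (after wave 3).  LANDED: `rbarExtendedAdequate` UNCONDITIONAL (…ThorneRbarAdequateUncond p154371, via the new Literature theorem
`isExtendedAdequate_range_heartRep_toMatrix`, CFSG-free — the GHT named fact is dropped from the line), the companions debts and
reduction (…ThorneCompanionsDebts p147495, …ThorneCompanionsReduction p149551: `stub_companions_of : MF1 → MF2 → G1 → G3 →
T.stub_companions`), G1 `stub_auxiliaryCMField` PROVED (…ThorneAuxiliaryField p153962 + …Lemmas p153487: `F' = ℚ(ζ₃, √-p)`), and of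
G3 everything about POINTS (…ThorneArithmeticPoints p151521: automatic continuity + integrality of all integral points, trace
polarization over `F'`, decomposition-group transport of the B-ordinary frame; `stub_arithmeticPoints_of : (W) → G3`).  Stub set
(7 = stubs_max, 7 sorries): `stub_minimalFamily` (K2⁺; M1 unprinted), `stub_lambdaFinite` (Λ-adic port, unprinted),
`stub_weightSpace` (= (W): the WEIGHT-SPACE CORE of G3 — Λ-adic weights are Artin-algebraic with gaps and dense near `x_C`;
needs LCFT on units for `K_λ`, a presentation of `Λ`, and label-analyticity of the middle row of `x_C` (a Picard `p`-adic Hodge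
input no typed hypothesis carries) — XL), `stub_hidaWall` (= MF1 ∧ MF2: Hida theory on the definite `U(3)` and the ordinary polarized
seed — the automorphic wall), `stub_pointAutomorphic` (lead; Thorne 2017 Thm 5.1 = wi-37169 + BLGGT/GG/CHT facts), `stub_remainderPlus`
(conceded complement), `stub_facts` (the six named Literature facts of char-zero's conditional stubs).
v5 (session 5).  RESHAPE: the universal weight-space stub (W) `stub_weightSpace` — not provable from the `OrdFamily` axioms (the middle
character of the Picard weight is untyped; `Spec Λ` is not pinned as the polarized weight space) and in truth a property of the intended
witness — is FOLDED into the family existential: `stub_minimalFamilyW : T.stub_minimalFamilyW` (= `T.stub_minimalFamily ∧ HasWeightData`,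
Defs …ThorneWeightData p158875); the companions stub and K1⁺ are relativised to families with weight data and re-derived from MF1 + MF2 + G1
alone (…ThorneWeightReduction p159438: `stub_companionsW_of`, `definiteHostPlusW_of`, `MuOrdinaryFamilyRT_of_thorneStubsW`).  Stub set (6 stubs,
6 sorries): `stub_minimalFamilyW` (M1 + P0 + Iwasawa presentation; conjecture-sized), `stub_lambdaFinite` (Λ-adic port, unprinted),
`stub_hidaWall` (MF1 ∧ MF2: Hida theory on the definite `U(3)`, absent), `stub_pointAutomorphic` (lead; blueprint
`Lines/thorne-minimal-lift-pointAutomorphic.md`: Thorne fact landed + facts F1–F8 + glue G1–G7), `stub_remainderPlus` (conceded complement =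
children B/C of the landed Split p158597), `stub_facts` (six Literature facts).  The strategist's route-level split is LANDED
(…Split p158597: `MuOrdinaryFamilyRT_of_subs`, child A `RTMuOrdinaryMinimal` = this line's deliverable).
v6 (session 5, blueprint `Lines/thorne-minimal-lift-pointAutomorphic.md` § 3).  INTERFACE RESHAPE of the lead's stub: the companion is taken
in THORNE-READY form `HasThorneCompanion` (= the clauses of `HasOrdinaryCompanion` ∧ (f) `UnramifiedOff` ∧ (g) `Qian2022.IsAutomorphic ι r^c`,
Defs …ThorneCompanionAut p160433), delivered by the wall MF1ᵃ (`Missing.hidaOrdinaryCompanionsAut` = MF1 + (g)); reductions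
…ThorneCompanionAutReduction p160931 (`stub_companionsT_of`, `definiteHostPlusT_of`, `MuOrdinaryFamilyRT_of_thorneStubsT`,
`rtMuOrdinaryMinimal_of_thorneStubsT`).  Stub set (6 stubs, 6 sorries): `stub_minimalFamilyW`, `stub_lambdaFinite`, `stub_hidaWallAut`
(MF1ᵃ ∧ MF2), `stub_pointAutomorphicT` (lead: from a Thorne-ready companion; facts F1 CHT 4.1.2 CM form LANDED p161276-pending /
F7 Gee–Geraghty Lemma 3.1.4(3) LANDED p161072 / ACC base change–descent in tree; F2, F4–F6, F8 to type; glue G1–G7),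
`stub_remainderPlus`, `stub_facts`.
v7 (session 5, later).  The twisting character of the lifting step is made a DATUM: `stub_pointAutomorphicTw` receives `θ` with `TwistData 𝓕.m F' S' θ`
(Defs …ThorneTwistData p166345) over an auxiliary field with `3` split from `F'⁺`; the level-enlarging reduction `definiteHostPlusTw_of`
(…ThorneTwistReduction p167851) produces `θ` ONCE per field from the Literature fact CHT 2008 Lemma 4.1.6
(`ClozelHarrisTaylor2008.exists_cm_character_sq_eq_cyclotomic_pow`, p166049) through the landed glue gω/gΦ/gmono (p167030/p167396/p167515).
Landed for the lead's stub meanwhile: facts F1 (CHT 4.1.2 CM form, p161276), F6 (Caraiani unramified compatibility, p166206), F7 (Gee–Geraghty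
3.1.4(3), p161072), F9 (ε ∘ Art = N, p164650); glue G1 p163073, G2/G2b p163483, G4 p165423, G4b p165724, G5 p165086, twist API p162327.  Stub set (6):
`stub_minimalFamilyW`, `stub_lambdaFinite`, `stub_hidaWallAut`, `stub_pointAutomorphicTw` (lead), `stub_remainderPlus`, `stub_factsTw` (= `T.stub_facts` ∧ the
CHT 4.1.6 fact).
v8 (session 5, later still).  THREE-WAY CUT of the lead's stub (Defs …ThornePointAutomorphicDebts p168235): `stub_pointAutomorphicTw` is DERIVED in this file by
`stub_pointAutomorphicTw_of` (kernel-checked) from the Thorne fact (for canonical Artin data), the existence of canonical Artin data, the Literature facts F1/F7/F9,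
the GALOIS input over the soluble CM extension `stub_thorneInputOverL` (PA-I — glue, the lead's remaining stub), and the two typed AUTOMORPHIC debts PA-C
`Missing.thorneCompanionOverL`, PA-O `Missing.classicalOfAutomorphicTwist` (`stub_paDebts`).  Stub set (7 = stubs_max): `stub_minimalFamilyW`, `stub_lambdaFinite`,
`stub_hidaWallAut`, `stub_thorneInputOverL` (lead, PROVABLE glue), `stub_paDebts` (automorphic debts), `stub_remainderPlus`, `stub_factsAll` (the Literature facts:
`T.stub_facts` ∧ CHT 4.1.6 ∧ CHT 4.1.2 ∧ GG 3.1.4(3) ∧ ε∘Art = N ∧ Thorne 5.1 for canonical Artin data ∧ canonical Artin data exist).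
v9 (session 5, end).  PA-I is PROVED and LANDED (`thorneInputOverL`, …ThornePAIAssembly p170895, from the landed glue H1–H9 …ThornePAI* and the facts F1/F7/F9 as
hypotheses), and the existence of canonical local Artin data is PROVED here (`canonicalArtinData_exists`, from the tree's local class field theory).  Stub set (6):
`stub_minimalFamilyW` (wall M1+P0), `stub_lambdaFinite` (wall: Λ-adic port), `stub_hidaWallAut` (wall: Hida theory on definite U(3)), `stub_paDebts` (automorphic debts
PA-C/PA-O, typed), `stub_remainderPlus` (children B/C of the landed split), `stub_factsAll` (named Literature facts only).  No glue stub remains: every remaining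
`sorry` is a wall, an automorphic debt, the conceded complement, or a conjunction of cited facts.
Composition: `MuOrdinaryFamilyRT_proof` concludes the crux BY NAME through the landed `MuOrdinaryFamilyRT_of_thorneStubsTw`.
-/

set_option linter.dupNamespace false

namespace Summit.Langlands.Langlands.Cruxes.MuOrdinaryFamilyRT.ThorneMinimalLift

open scoped NumberField Polynomial Matrix Classical
open Field IsDedekindDomain Polynomial Filter
open Literature.NumberTheory.GaloisRepresentations Literature.NumberTheory.Automorphic Literature.NumberTheory.PAdicHodge
open Literature.NumberTheory.NumberFields
open Summit.Langlands.Langlands.Cruxes.MuOrdinaryFamilyRT.CharZeroDominance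

noncomputable section

/-! ## 1. The registered stubs (v9: 6) -/

/-- **`stub_minimalFamilyW` — THE GALOIS FAMILY with its weight data (v5; K2⁺ ∧ (W) folded).**  A minimal integral B-ordinary
polarized `Λ`-adic family of dimension `≥ 4` through `ρ_C` over the Iwasawa algebra, carrying arithmetic weight data near the Picard weight
(`HasWeightData`).  OPEN — conjecture-sized: M1 `Missing.minimalOrdinaryBranch` (Kisin generic-fibre representability + Greenberg–Wiles count
with `E`-coefficients + Geraghty's flag scheme at the RAMIFIED prime; unprinted as such) + P0 `Missing.picardPolarized` + the presentation of
the branch over the polarized weight space (dense arithmetic weights; label-analyticity of the middle character of `x_C`). -/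
theorem stub_minimalFamilyW : T.stub_minimalFamilyW := by
  sorry

/-- **`stub_lambdaFinite` — the `Λ`-adic `R^{red} = T^{ord}` finiteness PORT at `p = n = 3`, `ζ₃ ∈ K` (family form,
`LambdaOrdinaryMinimalFinite`, …ThorneDebts § 2).**  UNPRINTED as one theorem (Geraghty Math. Ann. 373 §§3–5 with Thorne 2017
Prop 2.21 / Def 2.20 + GHT Thm 1.7 as inputs, BLGGT Lemma 1.2.3); `T.stub_finiteOverWeights` is derived from it below. -/
theorem stub_lambdaFinite : LambdaOrdinaryMinimalFinite := by
  sorry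

/-- **`stub_hidaWallAut` — the AUTOMORPHIC WALL of the companions stub** (v6): MF1ᵃ `Missing.hidaOrdinaryCompanionsAut` (Hida
theory on the definite unitary group `U(3)_{F'/F'⁺}` at `GL₃/F'`-level, concluding companions automorphic in Qian's characterising
sense: Geraghty 2019 Prop. 2.5.3 / Lemma 2.6.4 / Cor. 3.1.4 / Cor. 2.7.8, Labesse 2011, Guerberoff 2011, HLTT Thm A — absent from the
tree, paywalled acq-02323) and MF2 `Missing.ordinaryPolarizedSeed` (the residual-automorphy seed of route items 13759/13760 in ordinary
polarized form).  `T.stub_companionsT` is DERIVED below. -/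
theorem stub_hidaWallAut : Missing.hidaOrdinaryCompanionsAut ∧ Missing.ordinaryPolarizedSeed := by
  sorry

/-- **`stub_paDebts` — the two AUTOMORPHIC debts of the lifting step** (typed in …ThornePointAutomorphicDebts p168235, to be promoted: PA-C the Thorne-ready
companion base-changed and twisted into the format of hypothesis (iv) — ACC base change, twisting, Jacquet–Shalika, Caraiani —, PA-O the classicality clauses over `F'`
from the automorphy of the twist over `L` — ACC descent, untwisting, Caraiani, Satake integrality). -/
theorem stub_paDebts : Missing.thorneCompanionOverL ∧ Missing.classicalOfAutomorphicTwist := by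
  sorry

/-- The conceded complement (not a lemma of the line; to be promoted to the planned split of the crux). -/
theorem stub_remainderPlus : T.stub_remainderPlus := by
  sorry

/-- **`stub_factsAll` — the NAMED LITERATURE FACTS the composition consumes** (none the stub restated): `T.stub_facts` (char-zero's six: Picard λ-adic
representation, Arthur–Clozel ×2, cyclic cuspidal descent, infinity types, lang.S27) ∧ CHT 2008 Lemma 4.1.6 (`…exists_cm_character_sq_eq_cyclotomic_pow`, p166049) ∧ CHT 2008
Lemma 4.1.2 CM form (`…exists_solvable_cm_extension_local`, p161276) ∧ Gee–Geraghty 2012 Lemma 3.1.4 (3) (`…crystalline_of_ordinary_regular`, p161072) ∧ `ε ∘ Art = N`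
(`cyclotomicCharacter_artin_eq_norm`, p164650) ∧ Thorne 2017 Thm 5.1 for CANONICAL local Artin data (`Thorne2017.automorphyLifting_unitary_ordinaryMinimal 𝓐`, p148560).
(v9: the existence of canonical local Artin data is PROVED below, `canonicalArtinData_exists`.) -/
theorem stub_factsAll : T.stub_facts ∧ Literature.NumberTheory.GaloisRepresentations.ClozelHarrisTaylor2008.exists_cm_character_sq_eq_cyclotomic_pow ∧ Literature.NumberTheory.NumberFields.ClozelHarrisTaylor2008.exists_solvable_cm_extension_local ∧ GeeGeraghty2012.crystalline_of_ordinary_regular ∧ cyclotomicCharacter_artin_eq_norm ∧ (∀ 𝓐 : ∀ (K : Type) [Field K] [NumberField K] (v : HeightOneSpectrum (𝓞 K)), LocalArtinData (v.adicCompletion K), (∀ (K : Type) [Field K] [NumberField K] (v : HeightOneSpectrum (𝓞 K)), (𝓐 K v).IsCanonical) → Thorne2017.automorphyLifting_unitary_ordinaryMinimal 𝓐) := by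
  sorry

/-! ## 2. Composition (kernel-checked) -/

/-- **Canonical local Artin data exist at every completion of every number field** (local class field theory, PROVED in the tree:
`exists_isLocalArtinMap_holds` packaged by `LocalArtinData.ofExistsIsLocalArtinMap`, canonical by `rfl`). -/
theorem canonicalArtinData_exists :
    ∃ 𝓐 : ∀ (K : Type) [Field K] [NumberField K] (v : HeightOneSpectrum (𝓞 K)), LocalArtinData (v.adicCompletion K),
      ∀ (K : Type) [Field K] [NumberField K] (v : HeightOneSpectrum (𝓞 K)), (𝓐 K v).IsCanonical :=
  ⟨fun K _ _ v => LocalArtinData.ofExistsIsLocalArtinMap (exists_isLocalArtinMap_holds (v.adicCompletion K)),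
    fun K _ _ v => LocalArtinData.isCanonical_ofExistsIsLocalArtinMap _⟩


/-- **`stub_pointAutomorphicTw` from the Thorne fact, canonical Artin data, the three Literature facts of PA-I, PA-I itself (above) and the two automorphic
debts PA-C, PA-O** (kernel-checked: unpack the Thorne-ready companion; the LANDED PA-I `thorneInputOverL` (…ThornePAIAssembly) gives `L`, `τ`, `c` and the Galois half of Thorne's hypotheses for
`ρ' = (ρ_y|F' ⊗ θ)|L` with companion `(r^c ⊗ θ)|L`; PA-C gives the automorphic half; `thorne_apply` gives `IsAutomorphic ι ρ'`; PA-O descends, untwists and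
packages the classicality clauses over `F'`). -/
theorem stub_pointAutomorphicTw_of
    (hT : ∀ 𝓐 : ∀ (K : Type) [Field K] [NumberField K] (v : HeightOneSpectrum (𝓞 K)), LocalArtinData (v.adicCompletion K),
      (∀ (K : Type) [Field K] [NumberField K] (v : HeightOneSpectrum (𝓞 K)), (𝓐 K v).IsCanonical) →
      Thorne2017.automorphyLifting_unitary_ordinaryMinimal 𝓐)
    (h𝓐 : ∃ 𝓐 : ∀ (K : Type) [Field K] [NumberField K] (v : HeightOneSpectrum (𝓞 K)), LocalArtinData (v.adicCompletion K),
      ∀ (K : Type) [Field K] [NumberField K] (v : HeightOneSpectrum (𝓞 K)), (𝓐 K v).IsCanonical)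
    (hF1 : ClozelHarrisTaylor2008.exists_solvable_cm_extension_local)
    (hF7 : GeeGeraghty2012.crystalline_of_ordinary_regular) (hF9 : cyclotomicCharacter_artin_eq_norm)
    (hC : Missing.thorneCompanionOverL) (hO : Missing.classicalOfAutomorphicTwist) :
    ∀ (f : ℤ[X]) (ι : PadicAlgCl 3 ≃+* ℂ) (e : K →+* ℂ) (S₀ : Finset (HeightOneSpectrum (𝓞 K)))
      (ρC : FramedGaloisRep K (PadicAlgCl 3) 3) (𝓕 : OrdFamily f ι e S₀ ρC),
      Generic f → PicardInput f ι e S₀ ρC → MainClassPlus f S₀ ρC → PotUnramifiedFamily 𝓕 →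
    ∀ (F' : Type) [Field F'] [NumberField F'] [Algebra K F'] [IsGalois ℚ F'] [NumberField.IsCMField F']
      (hcpt' : isCompact_glFiniteIntegralLevel 3 F') (S' : Finset (HeightOneSpectrum (𝓞 F'))),
      Module.finrank K F' = 2 → ThreeSplitFromMaximalReal F' →
      ((rbar f 𝓕.B).comp (absGaloisRestrict K F').toMonoidHom).range = (rbar f 𝓕.B).range →
      (∀ w : HeightOneSpectrum (𝓞 F'), w.under (𝓞 K) ∈ S₀ → w ∈ S') →
    ∀ θ : absoluteGaloisGroup F' →ₜ* (PadicAlgCl 3)ˣ, TwistData 𝓕.m F' S' θ →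
    ∀ (y : 𝓕.R →+* PadicAlgCl 3) (ρy : FramedGaloisRep K (PadicAlgCl 3) 3),
      (∀ g, ρy g = pointRep 𝓕 y g) → FramedRep.IsAbsolutelyIrreducible (ρy.restrictField F') →
      HasThorneCompanion 𝓕 F' hcpt' S' y →
      ∃ P' : CuspidalAutomorphicRepData 3 F' hcpt',
        P'.1.IsRegularAlgebraic ∧
        ∀ w ∉ S', (∃ α : Multiset ℂ, P'.1.HasSatakeParamAt w α ∧
            ∀ a ∈ α, IsIntegral ℤ ((w.residueCard : ℂ) * a)) ∧
          (((3 : ℕ) : 𝓞 F') ∉ w.asIdeal → IsGaloisCompatibleAt P'.1 ι (ρy.restrictField F') w) := by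
  intro f ι e S₀ ρC 𝓕 hgen hin hM hpur F' _ _ _ _ _ hcpt' S' hdeg hsplit hrange hS' θ hθ y ρy hρy hirr hy
  obtain ⟨Pc, rc, -, -, hb, hc, hd₁, hd₂, hd₃, he, hf, haut⟩ := hy
  obtain ⟨𝓐, h𝓐c⟩ := h𝓐
  obtain ⟨L, iF, iN, iCM, iA, iG, hsol, τ, c, hG, hirrρ, hirrr, hpol, hunr⟩ :=
    thorneInputOverL hF1 hF7 hF9 𝓐 h𝓐c f ι e S₀ ρC 𝓕 hgen hin hM hpur F' S' hdeg hsplit hrange hS' θ hθ y ρy hρy hirr rc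
      hc hd₁ hd₂ hd₃ he hf
  have hcptL : isCompact_glFiniteIntegralLevel 3 L := isCompact_glFiniteIntegralLevel_holds 3 L
  obtain ⟨πL, hA⟩ := hC F' ι S' 𝓕.m θ hθ rc haut hb L hsol hirrr hcptL
  have hautρ : Qian2022.IsAutomorphic ι (FramedGaloisRep.restrictField L ((ρy.restrictField F').twist θ)) :=
    thorne_apply (hT 𝓐 h𝓐c) hcptL ι πL hG hA
  exact hO F' ι hcpt' S' 𝓕.m θ hθ (ρy.restrictField F') hpol hunr L hsol hirrρ hautρ

/-- **The lifting stub with twist datum, DERIVED** from the facts, PA-I and the automorphic debts (kernel-checked assembly above). -/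
theorem stub_pointAutomorphicTw :
    ∀ (f : ℤ[X]) (ι : PadicAlgCl 3 ≃+* ℂ) (e : K →+* ℂ) (S₀ : Finset (HeightOneSpectrum (𝓞 K)))
      (ρC : FramedGaloisRep K (PadicAlgCl 3) 3) (𝓕 : OrdFamily f ι e S₀ ρC),
      Generic f → PicardInput f ι e S₀ ρC → MainClassPlus f S₀ ρC → PotUnramifiedFamily 𝓕 →
    ∀ (F' : Type) [Field F'] [NumberField F'] [Algebra K F'] [IsGalois ℚ F'] [NumberField.IsCMField F']
      (hcpt' : isCompact_glFiniteIntegralLevel 3 F') (S' : Finset (HeightOneSpectrum (𝓞 F'))),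
      Module.finrank K F' = 2 → ThreeSplitFromMaximalReal F' →
      ((rbar f 𝓕.B).comp (absGaloisRestrict K F').toMonoidHom).range = (rbar f 𝓕.B).range →
      (∀ w : HeightOneSpectrum (𝓞 F'), w.under (𝓞 K) ∈ S₀ → w ∈ S') →
    ∀ θ : absoluteGaloisGroup F' →ₜ* (PadicAlgCl 3)ˣ, TwistData 𝓕.m F' S' θ →
    ∀ (y : 𝓕.R →+* PadicAlgCl 3) (ρy : FramedGaloisRep K (PadicAlgCl 3) 3),
      (∀ g, ρy g = pointRep 𝓕 y g) → FramedRep.IsAbsolutelyIrreducible (ρy.restrictField F') →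
      HasThorneCompanion 𝓕 F' hcpt' S' y →
      ∃ P' : CuspidalAutomorphicRepData 3 F' hcpt',
        P'.1.IsRegularAlgebraic ∧
        ∀ w ∉ S', (∃ α : Multiset ℂ, P'.1.HasSatakeParamAt w α ∧
            ∀ a ∈ α, IsIntegral ℤ ((w.residueCard : ℂ) * a)) ∧
          (((3 : ℕ) : 𝓞 F') ∉ w.asIdeal → IsGaloisCompatibleAt P'.1 ι (ρy.restrictField F') w) :=
  stub_pointAutomorphicTw_of stub_factsAll.2.2.2.2.2 canonicalArtinData_exists stub_factsAll.2.2.1 stub_factsAll.2.2.2.1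
    stub_factsAll.2.2.2.2.1 stub_paDebts.1 stub_paDebts.2

/-- The char-zero facts and the CHT 4.1.6 fact (projection of `stub_factsAll`). -/
theorem stub_factsTw : T.stub_facts ∧ Literature.NumberTheory.GaloisRepresentations.ClozelHarrisTaylor2008.exists_cm_character_sq_eq_cyclotomic_pow :=
  ⟨stub_factsAll.1, stub_factsAll.2.1⟩

/-- The six Literature facts of the earlier skeletons (projection). -/
theorem stub_facts : T.stub_facts :=
  stub_factsTw.1

/-- **`T.stub_thorneLiftTw` from its two halves** (real proof): clause (d) of `HasThorneCompanion` supplies the continuity and integrality of the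
point, `stub_pointGalois` (LANDED p142159) frames `ρ_y` and gives absolute irreducibility over `F'`, `stub_pointAutomorphicTw` the cuspidal `P'`;
together this is `IsClassicalOver`. -/
theorem thorneLiftTw_of_point
    (hG : ∀ (f : ℤ[X]) (ι : PadicAlgCl 3 ≃+* ℂ) (e : K →+* ℂ) (S₀ : Finset (HeightOneSpectrum (𝓞 K)))
      (ρC : FramedGaloisRep K (PadicAlgCl 3) 3) (𝓕 : OrdFamily f ι e S₀ ρC), Generic f →
      ∀ (F' : Type) [Field F'] [Algebra K F'], Module.finrank K F' = 2 →
      ∀ y : 𝓕.R →+* PadicAlgCl 3,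
        (∀ N : ℕ, ∃ M : ℕ, ∀ r ∈ IsLocalRing.maximalIdeal 𝓕.R ^ M, ‖y r‖ ≤ ((3 : ℝ)⁻¹) ^ N) →
        (∀ r : 𝓕.R, ‖y r‖ ≤ 1) →
        ∃ ρy : FramedGaloisRep K (PadicAlgCl 3) 3,
          (∀ g, ρy g = pointRep 𝓕 y g) ∧ FramedRep.IsAbsolutelyIrreducible (ρy.restrictField F'))
    (hA : ∀ (f : ℤ[X]) (ι : PadicAlgCl 3 ≃+* ℂ) (e : K →+* ℂ) (S₀ : Finset (HeightOneSpectrum (𝓞 K)))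
      (ρC : FramedGaloisRep K (PadicAlgCl 3) 3) (𝓕 : OrdFamily f ι e S₀ ρC),
      Generic f → PicardInput f ι e S₀ ρC → MainClassPlus f S₀ ρC → PotUnramifiedFamily 𝓕 →
      ∀ (F' : Type) [Field F'] [NumberField F'] [Algebra K F'] [IsGalois ℚ F'] [NumberField.IsCMField F']
        (hcpt' : isCompact_glFiniteIntegralLevel 3 F') (S' : Finset (HeightOneSpectrum (𝓞 F'))),
        Module.finrank K F' = 2 → ThreeSplitFromMaximalReal F' →
        ((rbar f 𝓕.B).comp (absGaloisRestrict K F').toMonoidHom).range = (rbar f 𝓕.B).range →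
        (∀ w : HeightOneSpectrum (𝓞 F'), w.under (𝓞 K) ∈ S₀ → w ∈ S') →
      ∀ θ : absoluteGaloisGroup F' →ₜ* (PadicAlgCl 3)ˣ, TwistData 𝓕.m F' S' θ →
      ∀ (y : 𝓕.R →+* PadicAlgCl 3) (ρy : FramedGaloisRep K (PadicAlgCl 3) 3),
        (∀ g, ρy g = pointRep 𝓕 y g) → FramedRep.IsAbsolutelyIrreducible (ρy.restrictField F') →
        HasThorneCompanion 𝓕 F' hcpt' S' y →
        ∃ P' : CuspidalAutomorphicRepData 3 F' hcpt',
          P'.1.IsRegularAlgebraic ∧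
          ∀ w ∉ S', (∃ α : Multiset ℂ, P'.1.HasSatakeParamAt w α ∧
              ∀ a ∈ α, IsIntegral ℤ ((w.residueCard : ℂ) * a)) ∧
            (((3 : ℕ) : 𝓞 F') ∉ w.asIdeal → IsGaloisCompatibleAt P'.1 ι (ρy.restrictField F') w)) :
    T.stub_thorneLiftTw := by
  intro f ι e S₀ ρC 𝓕 hgen hin hM hpur F' _ _ _ _ _ hcpt' S' hdeg hsplit hrange hS' θ hθ y hy
  obtain ⟨-, -, -, -, -, -, hcont, hint, -, -, -, -⟩ := id hy
  obtain ⟨ρy, hρy, hirr⟩ := hG f ι e S₀ ρC 𝓕 hgen F' hdeg y hcont hint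
  obtain ⟨P', hP'reg, hP'⟩ :=
    hA f ι e S₀ ρC 𝓕 hgen hin hM hpur F' hcpt' S' hdeg hsplit hrange hS' θ hθ y ρy hρy hirr hy
  refine ⟨ρy, fun g => ?_, hirr, P', hP'reg, hP'⟩
  rw [FramedRep.trace, hρy g]
  exact trace_pointRep 𝓕 y g

/-- Pointwise minimal automorphy lifting with twist datum, recomposed from the LANDED Galois half (`stub_pointGalois`, p142159) and the
automorphic half. -/
theorem stub_thorneLiftTw : T.stub_thorneLiftTw :=
  thorneLiftTw_of_point stub_pointGalois stub_pointAutomorphicTw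

/-- Finiteness over weight space, DERIVED (landed reduction `stub_finiteOverWeights_of`, p141007) from the port `stub_lambdaFinite` and the
unconditional `rbarExtendedAdequate` (p154371). -/
theorem stub_finiteOverWeights : T.stub_finiteOverWeights :=
  stub_finiteOverWeights_of stub_lambdaFinite rbarExtendedAdequate

/-- The v4 family stub, DERIVED from the v5 one (projection; landed handle `stub_minimalFamily_of_W`). -/
theorem stub_minimalFamily : T.stub_minimalFamily :=
  stub_minimalFamily_of_W stub_minimalFamilyW

/-- Thorne-ready companions over an auxiliary field with `3` split from `F'⁺`, for families WITH WEIGHT DATA, DERIVED (landed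
`stub_companionsS_of` p167851 — from MF1ᵃ, MF2 and the PROVED G1 `stub_auxiliaryCMField` p153962). -/
theorem stub_companionsS : T.stub_companionsS :=
  stub_companionsS_of stub_hidaWallAut.1 stub_hidaWallAut.2 stub_auxiliaryCMField

/-- **The crux from the six v7 stubs** (landed composition `MuOrdinaryFamilyRT_of_thorneStubsTw`, p167851: the CHT 4.1.6 fact feeds the
level-enlarging `definiteHostPlusTw_of`). -/
theorem MuOrdinaryFamilyRT_proof : Summit.Langlands.Langlands.Theses.PicardMuOrdinary.MuOrdinaryFamilyRT :=
  MuOrdinaryFamilyRT_of_thorneStubsTw stub_factsTw.2 stub_minimalFamilyW stub_finiteOverWeights stub_companionsS stub_thorneLiftTw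
    stub_remainderPlus stub_factsTw.1

/-- The same through the landed level-enlarging K1⁺ and the unfolded reduction `MuOrdinaryFamilyRT_of_plusW` (sanity). -/
example : Summit.Langlands.Langlands.Theses.PicardMuOrdinary.MuOrdinaryFamilyRT :=
  crux_iff.mpr <|
    MuOrdinaryFamilyRT_of_plusW (stub_picardInput_of stub_facts.1) stub_minimalFamilyW
      (definiteHostPlusTw_of stub_factsTw.2 stub_finiteOverWeights stub_companionsS stub_thorneLiftTw) stub_accumulation
      (stub_quadraticDescent_of stub_facts.2.1 stub_facts.2.2.1
        Literature.NumberTheory.Automorphic.exists_twist_quadraticSign_holds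
        stub_facts.2.2.2.1 stub_facts.2.2.2.2.1 stub_facts.2.2.2.2.2)
      stub_dictionary stub_remainderPlus

/-- **Child A of the landed route-level split** (`Split.RTMuOrdinaryMinimal`, p158597) from the v7 stubs WITHOUT the remainder and WITHOUT the
Picard existence fact (landed `rtMuOrdinaryMinimal_of_thorneStubsTw`, p167851). -/
theorem rtMuOrdinaryMinimal_of_stubs :
    Summit.Langlands.Langlands.Cruxes.MuOrdinaryFamilyRT.Split.RTMuOrdinaryMinimal :=
  rtMuOrdinaryMinimal_of_thorneStubsTw stub_factsTw.2 stub_minimalFamilyW stub_finiteOverWeights stub_companionsS stub_thorneLiftTw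
    stub_facts.2

/-! ### Disprover tests the statements survive (load-bearing lemmas of the shared chain, imported from `Negative/`) -/

example := @Summit.Langlands.Langlands.Theorems.MuOrdinaryFamilyRT.Negative.stub_accumulation_false_without_dominance
example := @Summit.Langlands.Langlands.Theorems.MuOrdinaryFamilyRT.Negative.stub_accumulation_false_without_normality
example := @Summit.Langlands.Langlands.Theorems.MuOrdinaryFamilyRT.Negative.muOrdinaryFamilyRT_iff_remainder

end

end Summit.Langlands.Langlands.Cruxes.MuOrdinaryFamilyRT.ThorneMinimalLift
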